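import Literature.AlgebraicGeometry.HodgeTheory.HodgeFramesOfChartBallFrames
import Literature.AlgebraicGeometry.HodgeTheory.HodgeFiltrationChartBallFramesOfFamily
import HarnessLib

/-!
# Holomorphic frames of the Hodge bundles `F^p 𝓗^k` from analytic chart-ball frames — the chart
# pinned to the holomorphic algebraic chart at the centre

Family `hodge`, layer `Literature/AlgebraicGeometry/HodgeTheory`; proof file (theorems only, no
definition, no named fact). A re-run of the tree's packaging theorem
`exists_hodgeFrames_of_chartBallFrames` (`HodgeFramesOfChartBallFrames`, Griffiths 1968 Thm. 1.1 ∕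
Voisin I Thm. 10.3) whose conclusion `∃ ψ : OpenPartialHomeomorph ↥univ ℂ^m, W₀ ⊆ ψ.source ∧ …
AnalyticOnNhd ℂ (fun z ↦ φ (w₂ i (ψ.symm z))) (ψ '' W₀)` is strengthened by the single conjunct

  `ψ = (Homeomorph.Set.univ (ComplexPoints S)).transOpenPartialHomeomorph (ComplexPoints.algebraicChart S m t₁.1)`.

In the tree's proof the chart IS this one (`chartAt` of `chartedSpaceOfCharts (algebraicChart S m) _`
re-spelled on the univ-subtype), but the existential of the statement — and of the named statement
`Griffiths1968_holomorphicHodgeSubbundlesQP` it feeds — erases the link to the algebraic `C^ω` atlas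
`isManifold_algebraicChart`; a consumer who must read the holomorphic coordinates in ANOTHER
algebraic chart (e.g. the period map of the universal family near a point, cell hodgecm-mathlib
U-e P4) needs the pin. With it, `Motives/AlgebraicChartAnalyticTransfer` turns
`AnalyticOnNhd … (ψ '' W₀)` into `DifferentiableOn ℂ (… ∘ (algebraicChart S m Q).symm) …` for every `Q`.

* `exists_hodgeFrames_of_chartBallFrames_algebraicChart` — the pinned theorem (the tree's proof,
  re-run verbatim over the tree's public helpers `exists_frame_hodgeStructure_F_of_frame_map`,
  `baseChange_symm_eq_of_continuation`, `linearIndependent_and_comap_eq_span_of_frame`; the new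
  conjunct is `rfl`);
* `griffiths1968_holomorphicHodgeSubbundlesQP_algebraicChart` — **Griffiths' theorem (QP form) with the
  chart pinned**: the statement of the tree's `Griffiths1968_holomorphicHodgeSubbundlesQP` for an
  explicit family (binders as there, minus the unused `Module.Finite`), plus the pin; proof = the
  tree's `griffiths1968_holomorphicHodgeSubbundlesQP_holds` (chart-ball frames
  `exists_chartBall_hodgeFrames`, then the pinned packaging).

Honest scope: packaging only, exactly as the original — the analytic chart-ball frames are
hypotheses (brick K7g ∕ `exists_chartBall_hodgeFrames`); nothing here says that HC or any rung is
proved.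

## References

* [Griffiths1968PeriodsII] P. Griffiths, Periods of integrals on algebraic manifolds II, Amer. J.
  Math. 90 (1968), Thm. 1.1.
* [VoisinHodgeI2002] C. Voisin, Hodge Theory and Complex Algebraic Geometry I, CUP 2002, §9.2.1,
  §10.2.1 Thm. 10.3.
-/

noncomputable section

open scoped Manifold ContDiff Topology TensorProduct
open CategoryTheory AlgebraicGeometry Function Set Filter Metric Complex Module
open Literature.AlgebraicTopology.SingularHomology
open Literature.Geometry.Kaehler Literature.Geometry.Manifold Literature.NumberTheory.Transcendental
open Literature.AlgebraicGeometry.Motives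

namespace Literature.AlgebraicGeometry.HodgeTheory

set_option backward.isDefEq.respectTransparency false

/-! ### The frames of `F^p 𝓗^k` from chart-ball frames, chart pinned -/

section Frame

variable {𝒳 S : SchemeOver ℂ} (f : 𝒳 ⟶ S)

/-- **Holomorphic frames of the Hodge bundles `F^p 𝓗^k` from analytic chart-ball frames — with the
chart PINNED.** Same inputs and same output as the tree's `exists_hodgeFrames_of_chartBallFrames`
(Griffiths 1968 Thm. 1.1 ∕ Voisin I Thm. 10.3, packaging step: VERBATIM the tail of
`Griffiths1968_holomorphicHodgeSubbundlesQP` at `(s, t₁, N)`), plus ONE conjunct recording WHICH chart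
`ψ` of the univ-subtype carries the holomorphic coordinates: `ψ` is the holomorphic algebraic chart
at `t₁`, `(Homeomorph.Set.univ _).transOpenPartialHomeomorph (ComplexPoints.algebraicChart S m t₁.1)`
(a chart of the `C^ω` atlas `isManifold_algebraicChart S m`, so the coordinates are holomorphic in
EVERY algebraic chart — `Motives/AlgebraicChartAnalyticTransfer`). The proof is the tree's, the extra
conjunct is `rfl`. [cite: VoisinHodgeI2002, §10.2.1 Thm. 10.3 and §9.2.1] [cite: Griffiths1968PeriodsII, Thm. 1.1] -/
theorem exists_hodgeFrames_of_chartBallFrames_algebraicChart {n m : ℕ}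
    (hf : IsSmoothProjectiveFamily f n) [AlgebraicGeometry.SmoothOfRelativeDimension m S.hom]
    [AlgebraicGeometry.IsSeparated S.hom]
    (hU : IsCohomologicallyLocallyTrivialOn f (Set.univ : Set (ComplexPoints S)))
    (A : ∀ t : ComplexPoints S, HodgeModel n (fiberOver f t)) (hA : ∀ t, (A t).IsHodgeSymmetric)
    (k : ℕ) (s t₁ : (Set.univ : Set (ComplexPoints S))) (N : Set (Set.univ : Set (ComplexPoints S)))
    (hN : N ∈ 𝓝 t₁) :
    letI := Motives.smoothOfRelativeDimension_total (m := m) f hf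
    letI : AlgebraicGeometry.Smooth 𝒳.hom := AlgebraicGeometry.SmoothOfRelativeDimension.smooth (n + m) _
    letI : AlgebraicGeometry.LocallyOfFiniteType 𝒳.hom := inferInstance
    letI : AlgebraicGeometry.Smooth S.hom := AlgebraicGeometry.SmoothOfRelativeDimension.smooth m _
    letI : AlgebraicGeometry.LocallyOfFiniteType S.hom := inferInstance
    letI := chartedSpaceOfCharts (ComplexPoints.algebraicChart 𝒳 (n + m))
      (ComplexPoints.mem_algebraicChart_source 𝒳 (n + m))
    letI := chartedSpaceOfCharts (ComplexPoints.algebraicChart S m)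
      (ComplexPoints.mem_algebraicChart_source S m)
    letI : ∀ b : ComplexPoints S, ChartedSpace (Fin n → ℂ) (ComplexPoints (fiberOver f b)) :=
      fun b ↦ (algebraicModel (hf.isSmoothProjective b)).chartedSpace
    letI : ∀ b : ComplexPoints S, IsManifold 𝓘(ℝ, Fin n → ℂ) ∞ (ComplexPoints (fiberOver f b)) :=
      fun b ↦ (algebraicModel (hf.isSmoothProjective b)).isManifold_real
    ∀ {r : ℝ} (Φ : (Fin m → ℂ) → ComplexPoints (fiberOver f t₁.1) → ComplexPoints 𝒳),
      (∀ x, Φ (extChartAt 𝓘(ℂ, Fin m → ℂ) t₁.1 t₁.1) x = AlgPoints.map (fiberι f t₁.1) x) →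
      ContMDiffOn (𝓘(ℝ, Fin m → ℂ).prod 𝓘(ℝ, Fin n → ℂ)) 𝓘(ℝ, Fin (n + m) → ℂ) ∞ (uncurry Φ)
        (ball (extChartAt 𝓘(ℂ, Fin m → ℂ) t₁.1 t₁.1) r ×ˢ univ) →
    ∀ (e : ∀ p ∈ ball (extChartAt 𝓘(ℂ, Fin m → ℂ) t₁.1 t₁.1) r,
        ComplexPoints (fiberOver f t₁.1) ≃ₘ^∞⟮𝓘(ℝ, Fin n → ℂ), 𝓘(ℝ, Fin n → ℂ)⟯
          ComplexPoints (fiberOver f ((extChartAt 𝓘(ℂ, Fin m → ℂ) t₁.1).symm p))),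
      (∀ p (hp : p ∈ ball (extChartAt 𝓘(ℂ, Fin m → ℂ) t₁.1 t₁.1) r), ∀ x,
        AlgPoints.map (fiberι f ((extChartAt 𝓘(ℂ, Fin m → ℂ) t₁.1).symm p)) (e p hp x) = Φ p x) →
      (∀ p : ℕ, ∃ r₀ : ℝ, 0 < r₀ ∧ r₀ ≤ r ∧
        ∃ (R : ℕ) (w : Fin R → (Fin m → ℂ) →
          complexDeRhamCohomology (Fin n → ℂ) (ComplexPoints (fiberOver f t₁.1)) k),
          (∀ i (φ : Module.Dual ℂ (complexDeRhamCohomology (Fin n → ℂ)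
            (ComplexPoints (fiberOver f t₁.1)) k)),
            AnalyticOnNhd ℂ (fun z ↦ φ (w i z)) (ball (extChartAt 𝓘(ℂ, Fin m → ℂ) t₁.1 t₁.1) r₀)) ∧
          ∀ z (_ : z ∈ ball (extChartAt 𝓘(ℂ, Fin m → ℂ) t₁.1 t₁.1) r₀)
            (hzr : z ∈ ball (extChartAt 𝓘(ℂ, Fin m → ℂ) t₁.1 t₁.1) r),
            LinearIndependent ℂ (fun i ↦ w i z) ∧
            Submodule.span ℂ (Set.range fun i ↦ w i z) =
              (⨆ pq ∈ {pq ∈ Finset.HasAntidiagonal.antidiagonal k | p ≤ pq.1},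
                hodgePQ (Fin n → ℂ) (ComplexPoints (fiberOver f
                  ((extChartAt 𝓘(ℂ, Fin m → ℂ) t₁.1).symm z))) k pq.1 pq.2).map
                (complexDeRhamCohomology.map (Fin n → ℂ) (e z hzr).contMDiff k)) →
      ∃ W₀ : Set (Set.univ : Set (ComplexPoints S)), IsOpen W₀ ∧ t₁ ∈ W₀ ∧ W₀ ⊆ N ∧
        IsPathConnected W₀ ∧
      ∃ ψ : OpenPartialHomeomorph (Set.univ : Set (ComplexPoints S)) (Fin m → ℂ), W₀ ⊆ ψ.source ∧
      ψ = (Homeomorph.Set.univ (ComplexPoints S)).transOpenPartialHomeomorph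
        (ComplexPoints.algebraicChart S m t₁.1) ∧
      ∀ (T₁ : singularCohomology ℚ ℚ (ComplexPoints (fiberOver f s.1)) k ≃ₗ[ℚ]
          singularCohomology ℚ ℚ (ComplexPoints (fiberOver f t₁.1)) k) (p : ℤ),
      ∃ (r₂ : ℕ) (w₂ : Fin r₂ → Set.Elem (Set.univ : Set (ComplexPoints S)) →
        ℂ ⊗[ℚ] singularCohomology ℚ ℚ (ComplexPoints (fiberOver f s.1)) k),
        (∀ t ∈ W₀, ∀ (ε' : Path t₁ t), (∀ r', ε' r' ∈ W₀) →
          ∀ (T : singularCohomology ℚ ℚ (ComplexPoints (fiberOver f s.1)) k ≃ₗ[ℚ]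
            singularCohomology ℚ ℚ (ComplexPoints (fiberOver f t.1)) k),
          (∀ v, ofRatClass _ k (T v) = transportFun f k hU ⟦ε'⟧ (ofRatClass _ k (T₁ v))) →
          LinearIndependent ℂ (fun i ↦ w₂ i t) ∧
            (((A t.1).hodgeStructure (hf.isSmoothProjective t.1) (hA t.1) k).comapEquiv T).F p =
              Submodule.span ℂ (Set.range fun i ↦ w₂ i t)) ∧
        (∀ (i : Fin r₂)
          (φ : Module.Dual ℂ (ℂ ⊗[ℚ] singularCohomology ℚ ℚ (ComplexPoints (fiberOver f s.1)) k)),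
          AnalyticOnNhd ℂ (fun z ↦ φ (w₂ i (ψ.symm z))) (ψ '' W₀)) := by
  -- ### instances
  haveI := Motives.smoothOfRelativeDimension_total (m := m) f hf
  haveI : AlgebraicGeometry.Smooth 𝒳.hom := AlgebraicGeometry.SmoothOfRelativeDimension.smooth (n + m) _
  haveI : AlgebraicGeometry.LocallyOfFiniteType 𝒳.hom := inferInstance
  haveI : AlgebraicGeometry.Smooth S.hom := AlgebraicGeometry.SmoothOfRelativeDimension.smooth m _
  haveI : AlgebraicGeometry.LocallyOfFiniteType S.hom := inferInstance
  letI csT := chartedSpaceOfCharts (ComplexPoints.algebraicChart 𝒳 (n + m))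
    (ComplexPoints.mem_algebraicChart_source 𝒳 (n + m))
  letI csB := chartedSpaceOfCharts (ComplexPoints.algebraicChart S m)
    (ComplexPoints.mem_algebraicChart_source S m)
  have hX : ∀ t : ComplexPoints S, IsSmoothProjective n (fiberOver f t) := fun t ↦ hf.isSmoothProjective t
  letI csF : ∀ b : ComplexPoints S, ChartedSpace (Fin n → ℂ) (ComplexPoints (fiberOver f b)) :=
    fun b ↦ (algebraicModel (hX b)).chartedSpace
  haveI : ∀ b, IsManifold 𝓘(ℝ, Fin n → ℂ) ∞ (ComplexPoints (fiberOver f b)) :=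
    fun b ↦ (algebraicModel (hX b)).isManifold_real
  set c := extChartAt 𝓘(ℂ, Fin m → ℂ) t₁.1 with hc
  intro r Φ hΦ0 hΦsm e he hw
  classical
  haveI : IsManifold 𝓘(ℂ, Fin (n + m) → ℂ) ω (ComplexPoints 𝒳) := isManifold_algebraicChart 𝒳 (n + m)
  haveI : IsManifold 𝓘(ℂ, Fin m → ℂ) ω (ComplexPoints S) := isManifold_algebraicChart S m
  haveI : IsManifold 𝓘(ℝ, Fin (n + m) → ℂ) ∞ (ComplexPoints 𝒳) := isManifold_real_of_isManifold_complex
  haveI : IsManifold 𝓘(ℝ, Fin m → ℂ) ∞ (ComplexPoints S) := isManifold_real_of_isManifold_complex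
  haveI : AlgebraicGeometry.IsSeparated 𝒳.hom := by
    haveI := hf.isProper
    have h : AlgebraicGeometry.IsSeparated (f.left ≫ S.hom) := inferInstance
    rwa [Over.w f] at h
  haveI : T2Space (ComplexPoints 𝒳) := ComplexPoints.t2Space_of_isSeparated 𝒳
  haveI : T2Space (ComplexPoints S) := ComplexPoints.t2Space_of_isSeparated S
  haveI : ∀ b, IsManifold 𝓘(ℂ, Fin n → ℂ) ω (ComplexPoints (fiberOver f b)) :=
    fun b ↦ (algebraicModel (hX b)).isManifold
  haveI : ∀ b, T2Space (ComplexPoints (fiberOver f b)) :=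
    fun b ↦ ComplexPoints.t2Space_of_isSmoothProjective (hX b)
  haveI : ∀ b, CompactSpace (ComplexPoints (fiberOver f b)) :=
    fun b ↦ ComplexPoints.compactSpace_of_isSmoothProjective (hX b)
  haveI : ∀ b, SigmaCompactSpace (ComplexPoints (fiberOver f b)) :=
    fun b ↦ (algebraicModel (hX b)).sigmaCompactSpace
  haveI hne : ∀ b : ComplexPoints S, Nonempty (ComplexPoints (fiberOver f b)) :=
    fun b ↦ (algebraicModel (hX b)).nonempty_carrier (hX b)
  -- the fibre embeddings `ι_b : X_b(ℂ) → 𝒳(ℂ)`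
  obtain ⟨-, hιall⟩ := isProperHolomorphicSubmersion_and_isFibreEmbedding_of_isSmoothProjectiveFamily
    (m := m) f hf
  -- ### (A) the frames on the reference fibre, one for every filtration step
  choose r₀ hr₀ hr₀r R w hwan hwframe using hw
  -- ### (B) the chart of the base at `t₁` and a small ball
  have hct₁ : t₁.1 ∈ c.source := mem_extChartAt_source (I := 𝓘(ℂ, Fin m → ℂ)) t₁.1
  have hsymmN : ∀ᶠ z in 𝓝 (c t₁.1),
      (⟨c.symm z, Set.mem_univ _⟩ : (Set.univ : Set (ComplexPoints S))) ∈ N := by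
    have hcs : ContinuousAt c.symm (c t₁.1) := continuousAt_extChartAt_symm t₁.1
    have hcont : ContinuousAt
        (fun z ↦ (⟨c.symm z, Set.mem_univ _⟩ : (Set.univ : Set (ComplexPoints S)))) (c t₁.1) :=
      (Homeomorph.Set.univ (ComplexPoints S)).symm.continuous.continuousAt.comp hcs
    have hval : (⟨c.symm (c t₁.1), Set.mem_univ _⟩ : (Set.univ : Set (ComplexPoints S))) = t₁ := by
      apply Subtype.ext
      exact extChartAt_to_inv (I := 𝓘(ℂ, Fin m → ℂ)) t₁.1
    have hN' : N ∈ 𝓝 ((⟨c.symm (c t₁.1), Set.mem_univ _⟩ : (Set.univ : Set (ComplexPoints S)))) := by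
      rw [hval]; exact hN
    exact hcont.preimage_mem_nhds hN'
  have hG : (c.target ∩ ⋂ p ∈ Finset.range (k + 1), ball (c t₁.1) (r₀ p)) ∩
      {z | (⟨c.symm z, Set.mem_univ _⟩ : (Set.univ : Set (ComplexPoints S))) ∈ N} ∈ 𝓝 (c t₁.1) :=
    Filter.inter_mem (Filter.inter_mem (extChartAt_target_mem_nhds (I := 𝓘(ℂ, Fin m → ℂ)) t₁.1)
      ((Filter.biInter_finset_mem _).2 fun p _ ↦ ball_mem_nhds _ (hr₀ p))) hsymmN
  obtain ⟨ρ, hρ, hρG⟩ := Metric.mem_nhds_iff.1 hG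
  have hDT : ball (c t₁.1) ρ ⊆ c.target := fun z hz ↦ (hρG hz).1.1
  have hD0 : ∀ p ≤ k, ball (c t₁.1) ρ ⊆ ball (c t₁.1) (r₀ p) := fun p hp z hz ↦
    (Set.mem_iInter₂.1 (hρG hz).1.2) p (Finset.mem_range.2 (Nat.lt_succ_of_le hp))
  have hDN : ∀ z ∈ ball (c t₁.1) ρ,
      (⟨c.symm z, Set.mem_univ _⟩ : (Set.univ : Set (ComplexPoints S))) ∈ N := fun z hz ↦ (hρG hz).2
  have hDr : ball (c t₁.1) ρ ⊆ ball (c t₁.1) r :=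
    (hD0 0 (Nat.zero_le k)).trans (ball_subset_ball (hr₀r 0))
  -- ### (C) the chart `ψ` of the univ-subtype and the neighbourhood `W₀`
  let ψ : OpenPartialHomeomorph (Set.univ : Set (ComplexPoints S)) (Fin m → ℂ) :=
    (Homeomorph.Set.univ (ComplexPoints S)).transOpenPartialHomeomorph (chartAt (Fin m → ℂ) t₁.1)
  have hψapply : ∀ t, ψ t = c t.1 := fun t ↦ rfl
  have hψsymm : ∀ z, (ψ.symm z : ComplexPoints S) = c.symm z := fun z ↦ rfl
  have hψsource : ∀ t, t ∈ ψ.source ↔ t.1 ∈ c.source := fun t ↦ by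
    rw [hc, extChartAt_source]; rfl
  have hψtarget : ∀ z, z ∈ c.target → z ∈ ψ.target := fun z hz ↦ by
    have h1 : c.symm z ∈ c.source := c.map_target hz
    have h2 : c (c.symm z) = z := c.right_inv hz
    rw [hc, extChartAt_source] at h1
    have h3 := (chartAt (Fin m → ℂ) t₁.1).map_source h1
    change chartAt (Fin m → ℂ) t₁.1 (c.symm z) ∈ _ at h3
    have h4 : chartAt (Fin m → ℂ) t₁.1 (c.symm z) = c (c.symm z) := rfl
    rw [h4, h2] at h3
    exact h3
  set W₀ : Set (Set.univ : Set (ComplexPoints S)) := ψ.source ∩ ψ ⁻¹' ball (c t₁.1) ρ with hW₀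
  have hW₀o : IsOpen W₀ := ψ.isOpen_inter_preimage isOpen_ball
  have ht₁W₀ : t₁ ∈ W₀ := ⟨(hψsource t₁).2 hct₁, by
    change ψ t₁ ∈ ball (c t₁.1) ρ; rw [hψapply]; exact mem_ball_self hρ⟩
  have hW₀src : ∀ t ∈ W₀, t.1 ∈ c.source := fun t ht ↦ (hψsource t).1 ht.1
  have hW₀ball : ∀ t ∈ W₀, c t.1 ∈ ball (c t₁.1) ρ := fun t ht ↦ ht.2
  have hW₀N : W₀ ⊆ N := fun t ht ↦ by
    have h := hDN _ (hW₀ball t ht)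
    have hval : (⟨c.symm (c t.1), Set.mem_univ _⟩ : (Set.univ : Set (ComplexPoints S))) = t :=
      Subtype.ext (c.left_inv (hW₀src t ht))
    rwa [hval] at h
  have hW₀img : W₀ = ψ.symm '' ball (c t₁.1) ρ := by
    rw [ψ.symm_image_eq_source_inter_preimage (fun z hz ↦ hψtarget z (hDT hz))]
  have hW₀pc : IsPathConnected W₀ := by
    rw [hW₀img]
    exact ((convex_ball (c t₁.1) ρ).isPathConnected ⟨c t₁.1, mem_ball_self hρ⟩).image'
      (ψ.continuousOn_symm.mono fun z hz ↦ hψtarget z (hDT hz))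
  have hψW₀ : ψ '' W₀ = ball (c t₁.1) ρ := by
    apply Set.Subset.antisymm
    · rintro _ ⟨t, ht, rfl⟩; exact ht.2
    · intro z hz
      refine ⟨ψ.symm z, ?_, ψ.right_inv (hψtarget z (hDT hz))⟩
      rw [hW₀img]; exact Set.mem_image_of_mem _ hz
  -- ### (D) the fibre maps `X_{t₁}(ℂ) ≃ X_t(ℂ)`, `t ∈ W₀`: transport of `e (c t)` along `c⁻¹ (c t) = t`
  have hexg : ∀ t (ht : t ∈ W₀), ∃ g : ComplexPoints (fiberOver f t₁.1) ≃ₘ^∞⟮𝓘(ℝ, Fin n → ℂ),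
      𝓘(ℝ, Fin n → ℂ)⟯ ComplexPoints (fiberOver f t.1),
      ∀ y, AlgPoints.map (fiberι f t.1) (g y) = Φ (c t.1) y := by
    intro t ht
    have hzr : c t.1 ∈ ball (c t₁.1) r := hDr (hW₀ball t ht)
    have key : ∀ b : ComplexPoints S, c.symm (c t.1) = b →
        ∃ g : ComplexPoints (fiberOver f t₁.1) ≃ₘ^∞⟮𝓘(ℝ, Fin n → ℂ), 𝓘(ℝ, Fin n → ℂ)⟯
          ComplexPoints (fiberOver f b), ∀ y, AlgPoints.map (fiberι f b) (g y) = Φ (c t.1) y := by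
      rintro b rfl
      exact ⟨e (c t.1) hzr, he (c t.1) hzr⟩
    exact key t.1 (c.left_inv (hW₀src t ht))
  choose eW heW using hexg
  let Φ' : ∀ t : (Set.univ : Set (ComplexPoints S)),
      C(ComplexPoints (fiberOver f t₁.1), ComplexPoints (fiberOver f t.1)) := fun t ↦
    if ht : t ∈ W₀ then ((eW t ht).toHomeomorph : C(ComplexPoints (fiberOver f t₁.1),
      ComplexPoints (fiberOver f t.1))) else ContinuousMap.const _ (Classical.arbitrary _)
  have hΦ'W : ∀ t (ht : t ∈ W₀), Φ' t = ((eW t ht).toHomeomorph :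
      C(ComplexPoints (fiberOver f t₁.1), ComplexPoints (fiberOver f t.1))) := fun t ht ↦ dif_pos ht
  have hΦ'apply : ∀ t (ht : t ∈ W₀) y, Φ' t y = eW t ht y := fun t ht y ↦ by
    rw [hΦ'W t ht]; rfl
  have hΦ'ι : ∀ t (ht : t ∈ W₀) y, AlgPoints.map (fiberι f t.1) (Φ' t y) = Φ (c t.1) y :=
    fun t ht y ↦ by rw [hΦ'apply t ht]; exact heW t ht y
  have hΦ'₁ : ∀ y, Φ' t₁ y = y := fun y ↦ by
    apply (hιall t₁.1).isClosedEmbedding.injective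
    rw [hΦ'ι t₁ ht₁W₀, hΦ0]
  have hbij : ∀ t ∈ W₀, Function.Bijective (singularCohomology.map ℂ ℂ (Φ' t) k) := by
    intro t ht
    rw [hΦ'W t ht]
    exact (singularCohomology.mapIso ℂ ℂ (eW t ht).toHomeomorph k).toLinearEquiv.bijective
  have hcont : ContinuousOn (fun yt : ComplexPoints (fiberOver f t₁.1) ×
      (Set.univ : Set (ComplexPoints S)) ↦ AlgPoints.map (fiberι f yt.2.1) (Φ' yt.2 yt.1))
      (Set.univ ×ˢ W₀) := by
    have hpair : ContinuousOn (fun yt : ComplexPoints (fiberOver f t₁.1) ×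
        (Set.univ : Set (ComplexPoints S)) ↦ (c yt.2.1, yt.1)) (Set.univ ×ˢ W₀) := by
      refine ContinuousOn.prodMk ?_ continuous_fst.continuousOn
      exact (continuousOn_extChartAt (I := 𝓘(ℂ, Fin m → ℂ)) t₁.1).comp
        (continuous_subtype_val.comp continuous_snd).continuousOn fun yt hyt ↦ hW₀src _ hyt.2
    have h1 : ContinuousOn (fun yt : ComplexPoints (fiberOver f t₁.1) ×
        (Set.univ : Set (ComplexPoints S)) ↦ uncurry Φ (c yt.2.1, yt.1)) (Set.univ ×ˢ W₀) :=
      hΦsm.continuousOn.comp hpair fun yt hyt ↦ ⟨hDr (hW₀ball _ hyt.2), Set.mem_univ _⟩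
    refine h1.congr fun yt hyt ↦ ?_
    exact hΦ'ι yt.2 hyt.2 yt.1
  -- ### (E) the frame vectors, read on the base fibre `X_{t₁}` and transported by `T₁⁻¹`
  let B : HodgeModel n (fiberOver f t₁.1) := algebraicModel (hX t₁.1)
  have hBpull : ∀ z : singularCohomology ℂ ℂ (ComplexPoints (fiberOver f t₁.1)) k,
      B.pullback k z = z := fun z ↦ by
    have hid : (⟨B.toComplexPoints, B.isAnalytification.isHomeomorph.continuous⟩ :
        C(B.carrier, ComplexPoints (fiberOver f t₁.1))) = ContinuousMap.id _ :=
      ContinuousMap.ext fun _ ↦ rfl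
    change singularCohomology.map ℂ ℂ ⟨B.toComplexPoints, B.isAnalytification.isHomeomorph.continuous⟩
      k z = z
    rw [hid, singularCohomology.map_id]
    rfl
  let yv : ∀ p : ℕ, Fin (R p) → (Fin m → ℂ) →
      ℂ ⊗[ℚ] singularCohomology ℚ ℚ (ComplexPoints (fiberOver f t₁.1)) k := fun p i z ↦
    (B.complexification (hX t₁.1) k).symm (B.deRham B.carrier k (w p i z))
  have hyv : ∀ p i z, B.complexification (hX t₁.1) k (yv p i z) =
      complexifyFun (integrationDeRhamIsoFamily (Fin n → ℂ)) k (w p i z) := fun p i z ↦ by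
    change B.complexification (hX t₁.1) k ((B.complexification (hX t₁.1) k).symm _) = _
    rw [LinearEquiv.apply_symm_apply]
    rfl
  -- ### conclusion
  refine ⟨W₀, hW₀o, ht₁W₀, hW₀N, hW₀pc, ψ, Set.inter_subset_left, rfl, fun T₁ p ↦ ?_⟩
  by_cases hpk : p ≤ (k : ℤ)
  · -- ### (F) the frame of the step `p ≤ k` along every continuation `T` of `T₁` inside `W₀`
    have hpn : p.toNat ≤ k := Int.toNat_le.2 hpk
    let w₂ : Fin (R p.toNat) → Set.Elem (Set.univ : Set (ComplexPoints S)) →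
        ℂ ⊗[ℚ] singularCohomology ℚ ℚ (ComplexPoints (fiberOver f s.1)) k := fun i t ↦
      if ht : t ∈ W₀ then (T₁.baseChange ℚ ℂ _ _).symm (yv p.toNat i (c t.1)) else 0
    have hwW : ∀ i t (ht : t ∈ W₀),
        w₂ i t = (T₁.baseChange ℚ ℂ _ _).symm (yv p.toNat i (c t.1)) := fun i t ht ↦ dif_pos ht
    refine ⟨R p.toNat, w₂, ?_, ?_⟩
    · intro t ht ε' hε' T hT
      have hzρ : c t.1 ∈ ball (c t₁.1) ρ := hW₀ball t ht
      have hz0 : c t.1 ∈ ball (c t₁.1) (r₀ p.toNat) := hD0 _ hpn hzρ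
      have hzr : c t.1 ∈ ball (c t₁.1) r := hDr hzρ
      -- the chart-ball frame, transported to the fibre OVER `t` (generalisation over the base point)
      have key : ∀ (b : ComplexPoints S) (g : ComplexPoints (fiberOver f t₁.1) ≃ₘ^∞⟮𝓘(ℝ, Fin n → ℂ),
          𝓘(ℝ, Fin n → ℂ)⟯ ComplexPoints (fiberOver f b)),
          (∀ y, AlgPoints.map (fiberι f b) (g y) = Φ (c t.1) y) → c.symm (c t.1) = b →
          LinearIndependent ℂ (fun i ↦ w p.toNat i (c t.1)) ∧
            Submodule.span ℂ (Set.range fun i ↦ w p.toNat i (c t.1)) =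
              (⨆ pq ∈ {pq ∈ Finset.HasAntidiagonal.antidiagonal k | p.toNat ≤ pq.1},
                hodgePQ (Fin n → ℂ) (ComplexPoints (fiberOver f b)) k pq.1 pq.2).map
                (complexDeRhamCohomology.map (Fin n → ℂ) g.contMDiff k) := by
        rintro b g hg rfl
        have hge : g = e (c t.1) hzr := Diffeomorph.ext fun y ↦
          (hιall _).isClosedEmbedding.injective (by rw [hg y, he (c t.1) hzr y])
        rw [hge]
        exact hwframe p.toNat (c t.1) hz0 hzr
      obtain ⟨hli₀, hspan₀⟩ := key t.1 (eW t ht) (heW t ht) (c.left_inv (hW₀src t ht))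
      obtain ⟨x, ⟨hli₁, hspan₁⟩, hxread⟩ := exists_frame_hodgeStructure_F_of_frame_map (hX t.1)
        (A t.1) (hA t.1) k (eW t ht) (Φ' t) (hΦ'apply t ht) (fun i ↦ w p.toNat i (c t.1)) p
        hli₀ hspan₀
      -- `w₂ i t = T_ℂ⁻¹ (x i)` for the transported frame vectors `x i`
      have hwj : ∀ i, w₂ i t = (T.baseChange ℚ ℂ _ _).symm (x i) := by
        intro i
        rw [hwW i t ht]
        refine (baseChange_symm_eq_of_continuation f k hU Φ' hcont hbij ht₁W₀ T₁ ε' hε' T hT ?_).symm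
        rw [hxread i]
        -- the reading at `t₁`: `Φ'_{t₁} = id`, `Θ_B = Θ'`
        have hid : Φ' t₁ = ContinuousMap.id _ := ContinuousMap.ext hΦ'₁
        rw [hid, singularCohomology.map_id]
        change _ = ofRatClassBaseChange _ k (yv p.toNat i (c t.1))
        rw [← hBpull (ofRatClassBaseChange _ k (yv p.toNat i (c t.1))),
          ← B.complexification_apply (hX t₁.1), hyv]
      rw [HodgeStructure.comapEquiv_F]
      exact linearIndependent_and_comap_eq_span_of_frame T hli₁ hspan₁ hwj
    · -- ### (G) the coordinates are fixed linear functionals of the analytic `w i`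
      intro i φ
      let φ' : Module.Dual ℂ (complexDeRhamCohomology (Fin n → ℂ)
          (ComplexPoints (fiberOver f t₁.1)) k) :=
        φ ∘ₗ ((T₁.baseChange ℚ ℂ _ _).symm.toLinearMap ∘ₗ
          ((B.complexification (hX t₁.1) k).symm.toLinearMap ∘ₗ (B.deRham B.carrier k).toLinearMap))
      have han : AnalyticOnNhd ℂ (fun z ↦ φ' (w p.toNat i z)) (ball (c t₁.1) ρ) :=
        (hwan p.toNat i φ').mono (hD0 _ hpn)
      rw [hψW₀]
      refine han.congr isOpen_ball fun z hz ↦ ?_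
      have hzW : ψ.symm z ∈ W₀ := by rw [hW₀img]; exact Set.mem_image_of_mem _ hz
      have hcz : c (ψ.symm z).1 = z := by rw [hψsymm]; exact c.right_inv (hDT hz)
      change _ = φ (w₂ i (ψ.symm z))
      rw [hwW _ _ hzW, hcz]
      rfl
  · -- ### the steps `p > k`: `F^p = 0`, the empty frame
    refine ⟨0, fun i ↦ Fin.elim0 i, fun t ht ε' hε' T hT ↦ ⟨linearIndependent_empty_type, ?_⟩,
      fun i ↦ Fin.elim0 i⟩
    rw [HodgeStructure.comapEquiv_F, HodgeModel.hodgeStructure_F,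
      HodgeModel.ratF_eq_bot _ (hX t.1) k (lt_of_not_ge hpk), ← LinearEquiv.coe_baseChange,
      Submodule.comap_bot, LinearEquiv.ker, Set.range_eq_empty, Submodule.span_empty]

/-- **Griffiths' theorem (Voisin I Thm. 10.3; Griffiths 1968 Thm. 1.1) for smooth projective families
with quasi-projective total space, chart PINNED**: the conclusion of the tree's
`Griffiths1968_holomorphicHodgeSubbundlesQP` for the family `f` at `(s, t₁, N)`, with the extra conjunct
`ψ = (Homeomorph.Set.univ _).transOpenPartialHomeomorph (ComplexPoints.algebraicChart S d t₁.1)` — the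
holomorphic coordinates of the Hodge frames are read in the holomorphic ALGEBRAIC chart at `t₁`.
Proof = the tree's `griffiths1968_holomorphicHodgeSubbundlesQP_holds` (`exists_chartBall_hodgeFrames`,
then `exists_hodgeFrames_of_chartBallFrames_algebraicChart`).
[cite: VoisinHodgeI2002, §10.2.1 Thm. 10.3 and §10.2.2] [cite: Griffiths1968PeriodsII, Thm. 1.1] -/
theorem griffiths1968_holomorphicHodgeSubbundlesQP_algebraicChart {n d : ℕ} (k : ℕ)
    (hf : IsSmoothProjectiveFamily f n) (hS : IsQuasiProjectiveOver S) (h𝒳 : IsQuasiProjectiveOver 𝒳)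
    [AlgebraicGeometry.SmoothOfRelativeDimension d S.hom]
    (hU : IsCohomologicallyLocallyTrivialOn f (Set.univ : Set (ComplexPoints S)))
    (A : ∀ t : ComplexPoints S, HodgeModel n (fiberOver f t)) (hA : ∀ t, (A t).IsHodgeSymmetric)
    (s t₁ : (Set.univ : Set (ComplexPoints S))) (N : Set (Set.univ : Set (ComplexPoints S)))
    (hN : N ∈ 𝓝 t₁) :
    letI : AlgebraicGeometry.Smooth S.hom := AlgebraicGeometry.SmoothOfRelativeDimension.smooth d _
    letI : AlgebraicGeometry.LocallyOfFiniteType S.hom := inferInstance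
    ∃ W : Set (Set.univ : Set (ComplexPoints S)), IsOpen W ∧ t₁ ∈ W ∧ W ⊆ N ∧ IsPathConnected W ∧
    ∃ ψ : OpenPartialHomeomorph (Set.univ : Set (ComplexPoints S)) (Fin d → ℂ),
      W ⊆ ψ.source ∧
      ψ = (Homeomorph.Set.univ (ComplexPoints S)).transOpenPartialHomeomorph
        (ComplexPoints.algebraicChart S d t₁.1) ∧
    ∀ (T₁ : singularCohomology ℚ ℚ (ComplexPoints (fiberOver f s.1)) k ≃ₗ[ℚ]
        singularCohomology ℚ ℚ (ComplexPoints (fiberOver f t₁.1)) k),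
      (∃ δ₁ : Path.Homotopic.Quotient s t₁,
        ∀ v, ofRatClass _ k (T₁ v) = transportFun f k hU δ₁ (ofRatClass _ k v)) →
      ∀ p : ℤ, ∃ (r : ℕ)
        (w : Fin r → Set.Elem (Set.univ : Set (ComplexPoints S)) →
          ℂ ⊗[ℚ] singularCohomology ℚ ℚ (ComplexPoints (fiberOver f s.1)) k),
        (∀ t ∈ W, ∀ (ε : Path t₁ t), (∀ r', ε r' ∈ W) →
          ∀ (T : singularCohomology ℚ ℚ (ComplexPoints (fiberOver f s.1)) k ≃ₗ[ℚ]
            singularCohomology ℚ ℚ (ComplexPoints (fiberOver f t.1)) k),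
          (∀ v, ofRatClass _ k (T v) = transportFun f k hU ⟦ε⟧ (ofRatClass _ k (T₁ v))) →
          LinearIndependent ℂ (fun i ↦ w i t) ∧
            (((A t.1).hodgeStructure (hf.isSmoothProjective t.1) (hA t.1) k).comapEquiv T).F p =
              Submodule.span ℂ (Set.range fun i ↦ w i t)) ∧
        (∀ (i : Fin r)
          (φ : Module.Dual ℂ (ℂ ⊗[ℚ] singularCohomology ℚ ℚ (ComplexPoints (fiberOver f s.1)) k)),
          AnalyticOnNhd ℂ (fun z ↦ φ (w i (ψ.symm z))) (ψ '' W)) := by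
  haveI : AlgebraicGeometry.IsSeparated S.hom := hS.isVarietyPair_ofScheme.isSeparated
  obtain ⟨r, Φ, e, r₀, R, w, -, -, hΦ0, -, hΦsm, -, he, hr₀, hr₀r, hwan, hwframe⟩ :=
    exists_chartBall_hodgeFrames f (d := d) k hf h𝒳 t₁.1
  obtain ⟨W₀, hW₀o, ht₁W₀, hW₀N, hW₀pc, ψ, hW₀ψ, hψ, hK7h⟩ :=
    exists_hodgeFrames_of_chartBallFrames_algebraicChart f hf hU A hA k s t₁ N hN Φ hΦ0 hΦsm e he
      (fun p ↦ ⟨r₀, hr₀, hr₀r, R p, w p, hwan p, hwframe p⟩)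
  exact ⟨W₀, hW₀o, ht₁W₀, hW₀N, hW₀pc, ψ, hW₀ψ, hψ, fun T₁ _ p ↦ hK7h T₁ p⟩

end Frame

end Literature.AlgebraicGeometry.HodgeTheory

end
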